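import Summits.CriticalPhenomena.PercolationContinuityZ3.Theorems.Transplant.GridCoverNets
import Summits.CriticalPhenomena.PercolationContinuityZ3.Theorems.Transplant.SkelPhiCylBall
import HarnessLib

/-!
# The `pts` net (cooperite, PtS) CARRIES an affine unit-step chart: outward steps (ι), 1-Lipschitz, translating frames with FOUR types —
# a multi-type frames-only unit-step carrier (the cleanest crystal-net instance of the interface that the one-type nodes exclude)

builds on p205010 (kernel theorem, internal audit signed; external expert review pending) — nothing in this file uses p205010; NOTHING is claimed
about any node (the one-type nodes N2/U/U_s do not apply: `pts` has two vertex orbits; no multi-type frames-only node is typed, by the lane's ruling (A4)).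
Lane `prim-bschramm`, seat `prim-bschramm-p4` (gen 19; PART C3, `HOME/bschramm/P4-GENERAL.md` §41.4b).  Helper file
(`--supports stmt-CriticalPhenomena-4575 --as helper`).  A POSITIVE structural fact complementing the method-void certificates of `nbo`, `lon`, `sod`.

THE NET.  PtS (cooperite), space group P4₂/mmc: Pt at `2c` (square planar), S at `2e` (tetrahedral), every bond Pt–S; 4-regular, bipartite, TWO vertex
orbits (coordination sequences `4 10 24 42 64 92 …` from Pt and `4 10 24 42 64 90 …` from S — checked numerically in the seat).  Scaled coordinates
`(2x, 2y, 4z)`: `Pt₁ = (0,1,0)`, `Pt₂ = (1,0,2)`, `S₁ = (0,0,1)`, `S₂ = (0,0,3)`, each `+ (2ℤ, 2ℤ, 4ℤ)`; bonds `Pt₁ ∼ Pt₁ + (0,±1,±1)`, `Pt₂ ∼ Pt₂ + (±1,0,±1)`.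
Integer model on `ℤ³` (`TableNet`, 4 classes): the site `(n₁, n₂, 4n₃ + c)` stands for `r_c + (2n₁, 2n₂, 4n₃)`; bond table `Pts.bonds`.
THE CHART.  `φ(p) = ½·[[1,−1,1],[1,−1,−1]]·p + (½,½)` is integer-valued on all four classes and maps the four bonds at EVERY site onto `{±e₀, ±e₁}`
bijectively; in model coordinates `Pts.chart x = (x₀ − x₁ + 2⌊x₂/4⌋ + g₀(c), x₀ − x₁ − 2⌊x₂/4⌋ + g₁(c))`, `g = (0,0), (2,0), (1,0), (2,−1)` on the classes.
* **`Pts.steps : Skelφ.Steps Pts.graph Pts.chart`** (the outward-step field (ι) at every vertex), **`Pts.lip : Skelφ.Lip Pts.graph Pts.chart`**,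
  **`Pts.frames : Skelφ.Frames Pts.graph Pts.chart Pts.types`** (translating frames = the lattice translations `TableNet.addIso`; four base vertices).
So `pts` is NOT method-void for the frames-only interface (P2-LATTICES rows 772/1012 list it as such): it has everything of `PlanarSkeletonFrm` except (κ) (not
attempted here: cylinders are tubes around the kernel direction `(1,1,0)` of the chart) and except ONE-typeness — and no `neg` at the S sites for this chart
(site symmetry `−4m2`; R-level), so it is not a `PlanarSkeletonNeg/Sign` customer either.  It is the test customer for the multi-type question (A4).
[cite: KozmaNitzan2024, §4 p. 15 (outward steps), p. 16 (Lemma 8: translating frames)] [cite: ConwaySloane1999, Ch. 4 §7.1]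
-/

namespace Summit.CriticalPhenomena.PercolationContinuityZ3.Theorems.Transplant

open Literature.Probability.Percolation Literature.Probability.LatticeModels SimpleGraph GridCover

namespace Pts

/-! ## §1 The `pts` graph on `ℤ³` -/

/-- The bond table of `pts` (classes `0 = Pt₁, 1 = Pt₂, 2 = S₁, 3 = S₂`). [cite: ConwaySloane1999, Ch. 4 §7.1] -/
def bonds : Fin 4 → Finset (Site 3) :=
  ![{![0, 0, -1], ![0, 0, 2], ![0, 1, -1], ![0, 1, 2]},
    {![0, 0, 1], ![0, 0, 2], ![1, 0, 1], ![1, 0, 2]},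
    {![-1, 0, -1], ![0, -1, -2], ![0, 0, -2], ![0, 0, -1]},
    {![-1, 0, -2], ![0, -1, 1], ![0, 0, -2], ![0, 0, 1]}]

/-- No zero bond. [folklore] -/
theorem zero_notMem_bonds : ∀ c, (0 : Site 3) ∉ bonds c := by decide

/-- The bond table is symmetric. [folklore] -/
theorem neg_mem_bonds : ∀ c, ∀ v ∈ bonds c, -v ∈ bonds (TableNet.tgt 3 c v) := by decide

/-- Four bonds at every site. [folklore] -/
theorem card_bonds : ∀ c, (bonds c).card = 4 := by decide

/-- **The `pts` graph.** [cite: ConwaySloane1999, Ch. 4 §7.1] -/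
def graph : SimpleGraph (Site 3) := TableNet.graph 3 bonds

/-- The `pts` graph is locally finite. [folklore] -/
noncomputable instance graph_locallyFinite : graph.LocallyFinite := TableNet.graph_locallyFinite

/-- `pts` is 4-regular. [folklore] -/
theorem degree_eq (x : Site 3) : graph.degree x = 4 := TableNet.degree_eq zero_notMem_bonds neg_mem_bonds card_bonds x

/-- A table bond is an edge. [folklore] -/
theorem adj_of_mem {x y : Site 3} (h : y - x ∈ bonds (TableNet.cls 3 x)) : graph.Adj x y := TableNet.adj_of_mem zero_notMem_bonds h

/-! ## §2 The affine chart -/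

/-- Class offsets of the chart, first coordinate. [folklore] -/
def g₀ : Fin 4 → ℤ := ![0, 2, 1, 2]

/-- Class offsets of the chart, second coordinate. [folklore] -/
def g₁ : Fin 4 → ℤ := ![0, 0, 0, -1]

/-- **The chart** `φ = ½·[[1,−1,1],[1,−1,−1]]·p + (½,½)` in model coordinates. [folklore] -/
def chart (x : Site 3) : Site 2 :=
  ![x 0 - x 1 + 2 * (x 2 / 4) + g₀ (TableNet.cls 3 x), x 0 - x 1 - 2 * (x 2 / 4) + g₁ (TableNet.cls 3 x)]

/-- The class of `x` is determined by `x₂ mod 4`. [folklore] -/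
theorem cls_eq_iff (x : Site 3) (c : Fin 4) : TableNet.cls 3 x = c ↔ x 2 % 4 = (c : ℕ) := by
  constructor
  · intro h; have := TableNet.cls_val 3 x; rw [h] at this; exact_mod_cast this.symm
  · intro h; apply Fin.ext; have := TableNet.cls_val 3 x
    have e : (((TableNet.cls 3 x : ℕ) : ℤ)) = ((c : ℕ) : ℤ) := by rw [this]; exact_mod_cast h
    exact_mod_cast e

/-- The chart, coordinate 0. [folklore] -/
theorem chart_zero (x : Site 3) : chart x 0 = x 0 - x 1 + 2 * (x 2 / 4) + g₀ (TableNet.cls 3 x) := rfl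

/-- The chart, coordinate 1. [folklore] -/
theorem chart_one (x : Site 3) : chart x 1 = x 0 - x 1 - 2 * (x 2 / 4) + g₁ (TableNet.cls 3 x) := rfl

/-- The displacement of the chart along a bond `d` from a class-`c` site to a class-`c'` site, coordinate 0. [folklore] -/
theorem chart_add_zero (x d : Site 3) (c c' : Fin 4) (hc : TableNet.cls 3 x = c) (hc' : TableNet.cls 3 (x + d) = c') (q : ℤ)
    (hq : (x 2 + d 2) / 4 = x 2 / 4 + q) : chart (x + d) 0 = chart x 0 + (d 0 - d 1 + 2 * q + (g₀ c' - g₀ c)) := by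
  rw [chart_zero, chart_zero, hc, hc', Pi.add_apply, Pi.add_apply, Pi.add_apply, hq]; ring

/-- The same, coordinate 1. [folklore] -/
theorem chart_add_one (x d : Site 3) (c c' : Fin 4) (hc : TableNet.cls 3 x = c) (hc' : TableNet.cls 3 (x + d) = c') (q : ℤ)
    (hq : (x 2 + d 2) / 4 = x 2 / 4 + q) : chart (x + d) 1 = chart x 1 + (d 0 - d 1 - 2 * q + (g₁ c' - g₁ c)) := by
  rw [chart_one, chart_one, hc, hc', Pi.add_apply, Pi.add_apply, Pi.add_apply, hq]; ring

/-- **(ι) OUTWARD UNIT STEPS at every site of `pts`.** [cite: KozmaNitzan2024, §4 p. 15] -/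
theorem steps : Skelφ.Steps graph chart := by
  intro v i σ
  obtain ⟨c, hc⟩ : ∃ c, TableNet.cls 3 v = c := ⟨_, rfl⟩
  have hv : v 2 % 4 = (c : ℕ) := (cls_eq_iff v c).1 hc
  -- the bond `d` realising the target `σ eᵢ` from class `c`, landing in class `c'`, with carry `q` in `⌊x₂/4⌋`
  have key : ∀ (d : Site 3), d ∈ bonds c → ∀ c' : Fin 4, TableNet.tgt 3 c d = c' → ∀ q : ℤ, (v 2 + d 2) / 4 = v 2 / 4 + q →
      d 0 - d 1 + 2 * q + (g₀ c' - g₀ c) = (Pi.single i (σ : ℤ) : Site 2) 0 →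
      d 0 - d 1 - 2 * q + (g₁ c' - g₁ c) = (Pi.single i (σ : ℤ) : Site 2) 1 →
      ∃ v' : Site 3, graph.Adj v v' ∧ chart v' = chart v + Pi.single i (σ : ℤ) := by
    intro d hd c' hc' q hq he0 he1
    have hcd : TableNet.cls 3 (v + d) = c' := by rw [TableNet.cls_add, hc, hc']
    refine ⟨v + d, adj_of_mem (by rw [add_sub_cancel_left, hc]; exact hd), ?_⟩
    funext j
    fin_cases j
    · exact (chart_add_zero v d c c' hc hcd q hq).trans (by rw [he0]; rfl)
    · exact (chart_add_one v d c c' hc hcd q hq).trans (by rw [he1]; rfl)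
  rcases Int.units_eq_one_or σ with hσ | hσ <;> subst hσ <;> fin_cases i <;> fin_cases c
  · exact key ![0, 0, 2] (by decide) 2 (by decide) 0 (by simp at hv; simp; omega) (by decide) (by decide)
  · exact key ![1, 0, 2] (by decide) 3 (by decide) 0 (by simp at hv; simp; omega) (by decide) (by decide)
  · exact key ![0, 0, -1] (by decide) 1 (by decide) 0 (by simp at hv; simp; omega) (by decide) (by decide)
  · exact key ![0, -1, 1] (by decide) 0 (by decide) 1 (by simp at hv; simp; omega) (by decide) (by decide)
  · exact key ![0, 0, -1] (by decide) 3 (by decide) (-1) (by simp at hv; simp; omega) (by decide) (by decide)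
  · exact key ![1, 0, 1] (by decide) 2 (by decide) 0 (by simp at hv; simp; omega) (by decide) (by decide)
  · exact key ![0, -1, -2] (by decide) 0 (by decide) 0 (by simp at hv; simp; omega) (by decide) (by decide)
  · exact key ![0, 0, -2] (by decide) 1 (by decide) 0 (by simp at hv; simp; omega) (by decide) (by decide)
  · exact key ![0, 1, -1] (by decide) 3 (by decide) (-1) (by simp at hv; simp; omega) (by decide) (by decide)
  · exact key ![0, 0, 1] (by decide) 2 (by decide) 0 (by simp at hv; simp; omega) (by decide) (by decide)
  · exact key ![0, 0, -2] (by decide) 0 (by decide) 0 (by simp at hv; simp; omega) (by decide) (by decide)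
  · exact key ![-1, 0, -2] (by decide) 1 (by decide) 0 (by simp at hv; simp; omega) (by decide) (by decide)
  · exact key ![0, 1, 2] (by decide) 2 (by decide) 0 (by simp at hv; simp; omega) (by decide) (by decide)
  · exact key ![0, 0, 2] (by decide) 3 (by decide) 0 (by simp at hv; simp; omega) (by decide) (by decide)
  · exact key ![-1, 0, -1] (by decide) 1 (by decide) 0 (by simp at hv; simp; omega) (by decide) (by decide)
  · exact key ![0, 0, 1] (by decide) 0 (by decide) 1 (by simp at hv; simp; omega) (by decide) (by decide)

/-- **The chart is 1-Lipschitz (sup-norm) along every bond** — indeed every bond is a unit step. [cite: KozmaNitzan2024, §4 p. 15] -/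
theorem lip : Skelφ.Lip graph chart := by
  intro u w h i
  have hdeg := (degree_eq u).le
  obtain ⟨k, hk⟩ := exists_code steps hdeg h
  have := congrFun hk i
  rw [Pi.sub_apply] at this
  rw [abs_sub_comm, this]
  fin_cases i <;> fin_cases k <;> decide

/-- The four base vertices `r_c = (0, 0, c)`, one per class. [folklore] -/
def types : Finset (Site 3) := {![0, 0, 0], ![0, 0, 1], ![0, 0, 2], ![0, 0, 3]}

/-- **Translating frames**: every site is a lattice translate (`TableNet.addIso`) of the base vertex of its class, and lattice translations translate
the chart. [cite: KozmaNitzan2024, §4 p. 16 (Lemma 8)] -/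
theorem frames : Skelφ.Frames graph chart types := by
  intro v
  obtain ⟨c, hc⟩ : ∃ c, TableNet.cls 3 v = c := ⟨_, rfl⟩
  have hv : v 2 % 4 = (c : ℕ) := (cls_eq_iff v c).1 hc
  -- base vertex `t = (0,0,c)` and the lattice vector `u = v − t` (third coordinate divisible by 4)
  set t : Site 3 := ![0, 0, ((c : ℕ) : ℤ)] with ht
  have ht2 : t 2 = ((c : ℕ) : ℤ) := rfl
  have htc : TableNet.cls 3 t = c := (cls_eq_iff t c).2 (by rw [ht2]; have := c.isLt; omega)
  have hu : ((3 + 1 : ℕ) : ℤ) ∣ (v - t) 2 := by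
    rw [Pi.sub_apply, ht2]; norm_num; omega
  refine ⟨t, ?_, TableNet.addIso (v - t) hu, ?_, fun w => ?_⟩
  · fin_cases c <;> simp [types, ht]
  · show t + (v - t) = v
    abel
  · show chart (w + (v - t)) = chart w + (chart v - chart t)
    have hcw : TableNet.cls 3 (w + (v - t)) = TableNet.cls 3 w := TableNet.cls_add_of_dvd w (v - t) hu
    obtain ⟨q, hq⟩ : ∃ q : ℤ, v 2 = 4 * q + (c : ℕ) := ⟨v 2 / 4, by omega⟩
    funext i
    fin_cases i
    · show chart (w + (v - t)) 0 = chart w 0 + (chart v 0 - chart t 0)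
      simp only [chart_zero, hcw, hc, htc, Pi.add_apply, Pi.sub_apply, ht2]
      have e1 : (w 2 + (v 2 - ((c : ℕ) : ℤ))) / 4 = w 2 / 4 + q := by omega
      have e2 : v 2 / 4 = q := by omega
      have e3 : (((c : ℕ) : ℤ)) / 4 = 0 := by have := c.isLt; omega
      simp only [ht, Matrix.cons_val_zero, Matrix.cons_val_one, e2, e3]
      rw [e1]; ring
    · show chart (w + (v - t)) 1 = chart w 1 + (chart v 1 - chart t 1)
      simp only [chart_one, hcw, hc, htc, Pi.add_apply, Pi.sub_apply, ht2]
      have e1 : (w 2 + (v 2 - ((c : ℕ) : ℤ))) / 4 = w 2 / 4 + q := by omega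
      have e2 : v 2 / 4 = q := by omega
      have e3 : (((c : ℕ) : ℤ)) / 4 = 0 := by have := c.isLt; omega
      simp only [ht, Matrix.cons_val_zero, Matrix.cons_val_one, e2, e3]
      rw [e1]; ring

end Pts

end Summit.CriticalPhenomena.PercolationContinuityZ3.Theorems.Transplant
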